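import Summits.AtomisticToContinuum.FouriersLaw.Theorems.ParityLiouvilleSeedWindowLimitDefs
import Summits.AtomisticToContinuum.FouriersLaw.Theorems.ParityLiouvilleSeedCesaroUpgrade

/-!
# Regularity of a window limit (helper for `WindowLimit`)

Helper file for the route item `ParityLiouvilleSeed.WindowLimit` (`stmt-AtomisticToContinuum-13982`).
The lower semicontinuity of the relative entropy along weak limits and the box marginals of
shift-invariant measures are taken from the sibling item's toolkit
(`CesaroUpgrade.klDiv_le_of_tendsto_of_klDiv_le`, `CesaroUpgrade.boxMarginal_map_shift_iterate`,
`CesaroUpgrade.map_shift_iterate_of_isShiftInvariant`); this file only assembles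

* `boxMarginal_add_nat_of_isShiftInvariant` — box marginals of a shift-invariant measure do not depend on
  the position of the box;
* `klDiv_boxMarginal_window_limit_le` — the uniform regularity bound of the steady states (regularity
  hypothesis of `WindowLimit`, shift-invariant Gibbs reference) passes to every window limit: the box
  marginals of the centred window measures converge weakly, and eventually each of them IS a box marginal
  of a steady state over a box inside the chain.

Nothing here closes an item.
-/

noncomputable section

namespace Summit.AtomisticToContinuum.FouriersLaw.Theorems.WindowLimit

open MeasureTheory Filter Topology Set InformationTheory
open scoped ENNReal
open Literature.MathematicalPhysics.KineticTheory.HeatConduction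

/-- **Box marginals of a shift-invariant measure do not depend on the position of the box.** [folklore] -/
theorem boxMarginal_add_nat_of_isShiftInvariant {μ : Measure ChainConfig} (hμ : IsShiftInvariant μ) (a : ℤ)
    (n k : ℕ) : boxMarginal (a + k) n μ = boxMarginal a n μ := by
  rw [← CesaroUpgrade.boxMarginal_map_shift_iterate a n k μ, CesaroUpgrade.map_shift_iterate_of_isShiftInvariant hμ]

variable {ω₂ lam β γ T_L T_R : ℝ}

/-- **The uniform regularity bound passes to every window limit.** If the centred window measures of
`μ (Nk k)` (`Nk → ∞`) converge weakly to `ν`, the reference `μT` is a shift-invariant probability measure,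
and every `μ_N` has `KL(μ_N|_Λ ‖ μT|_Λ) ≤ C|Λ|` on all boxes `Λ ⊆ {0, …, N-1}` (`C < ∞`), then
`KL(ν|_Λ ‖ μT|_Λ) ≤ C|Λ|` on every box `Λ = {a, …, a+n}` of `ℤ` (weak lower semicontinuity of the
relative entropy, `CesaroUpgrade.klDiv_le_of_tendsto_of_klDiv_le`). [folklore] -/
theorem klDiv_boxMarginal_window_limit_le (μ : (N : ℕ) → Measure (PhaseSpace N))
    (hprob : ∀ N, IsProbabilityMeasure (μ N)) {Nk : ℕ → ℕ} (hNk : Tendsto Nk atTop atTop)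
    {ν : Measure ChainConfig} [IsProbabilityMeasure ν]
    (hlim : Tendsto (fun k => (haveI := hprob (Nk k); windowPM (μ (Nk k)))) atTop (𝓝 (toPM ν)))
    {μT : Measure ChainConfig} [IsProbabilityMeasure μT] (hS : IsShiftInvariant μT) {C : ℝ≥0∞} (hC : C ≠ ⊤)
    (hreg : ∀ (N : ℕ) (a n : ℕ) (h : a + (n + 1) ≤ N),
      klDiv ((μ N).map (fun x => fun i : Fin (n + 1) =>
        (x.1 (Fin.castLE h (Fin.natAdd a i)), x.2 (Fin.castLE h (Fin.natAdd a i)))))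
        (boxMarginal (a : ℤ) n μT) ≤ C * (n + 1))
    (a : ℤ) (n : ℕ) :
    klDiv (boxMarginal a n ν) (boxMarginal a n μT) ≤ C * (n + 1) := by
  have hbox : Continuous (boxRestrictAt a n) := continuous_pi fun i => continuous_apply _
  haveI : IsProbabilityMeasure (boxMarginal a n μT) :=
    Measure.isProbabilityMeasure_map (boxRestrictAt_measurable a n).aemeasurable
  have hfin : C * (n + 1) ≠ ⊤ := ENNReal.mul_ne_top hC (by simp)
  -- eventually the box `a + Nk k / 2, …` lies inside the chain
  obtain ⟨K₀, hK₀⟩ := eventually_atTop.1 (hNk.eventually_ge_atTop (2 * (a.natAbs + n + 2)))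
  -- the shifted sequence of box marginals converges weakly to the box marginal of `ν`
  set ρs : ℕ → ProbabilityMeasure (Fin (n + 1) → ℝ × ℝ) := fun k =>
    (haveI := hprob (Nk (k + K₀)); windowPM (μ (Nk (k + K₀)))).map hbox.measurable.aemeasurable with hρs
  set ρ : ProbabilityMeasure (Fin (n + 1) → ℝ × ℝ) := (toPM ν).map hbox.measurable.aemeasurable with hρ
  have hlim' : Tendsto (fun k => (haveI := hprob (Nk (k + K₀)); windowPM (μ (Nk (k + K₀))))) atTop
      (𝓝 (toPM ν)) := hlim.comp (tendsto_add_atTop_nat K₀)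
  have hconv : Tendsto ρs atTop (𝓝 ρ) := ProbabilityMeasure.tendsto_map_of_tendsto_of_continuous _ _ hlim' hbox
  have hρeq : (ρ : Measure (Fin (n + 1) → ℝ × ℝ)) = boxMarginal a n ν := by
    rw [hρ, ProbabilityMeasure.toMeasure_map, coe_toPM]; rfl
  rw [← hρeq]
  refine CesaroUpgrade.klDiv_le_of_tendsto_of_klDiv_le hconv (boxMarginal a n μT) hfin fun k => ?_
  -- the `k`-th box marginal is a box marginal of a steady state over a box inside the chain
  have hk : 2 * (a.natAbs + n + 2) ≤ Nk (k + K₀) := hK₀ _ (Nat.le_add_left _ _)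
  set N := Nk (k + K₀) with hN
  haveI := hprob N
  have hc0 : 0 ≤ a + (N / 2 : ℕ) := by push_cast; omega
  set a' : ℕ := (a + (N / 2 : ℕ)).toNat with ha'
  have ha'eq : a + (N / 2 : ℕ) = (a' : ℤ) := by rw [ha', Int.toNat_of_nonneg hc0]
  have h : a' + (n + 1) ≤ N := by omega
  have e1 : (ρs k : Measure (Fin (n + 1) → ℝ × ℝ)) = (μ N).map (fun x => fun i : Fin (n + 1) =>
      (x.1 (Fin.castLE h (Fin.natAdd a' i)), x.2 (Fin.castLE h (Fin.natAdd a' i)))) := by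
    rw [hρs, ProbabilityMeasure.toMeasure_map, coe_windowPM,
      Measure.map_map (boxRestrictAt_measurable a n) (measurable_embed _ _)]
    congr 1
    funext x
    exact boxRestrictAt_embed N (N / 2) ha'eq h x
  have e2 : boxMarginal a n μT = boxMarginal (a' : ℤ) n μT := by
    rw [← ha'eq, boxMarginal_add_nat_of_isShiftInvariant hS]
  rw [e1, e2]
  exact hreg N a' n h

end Summit.AtomisticToContinuum.FouriersLaw.Theorems.WindowLimit

end
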